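import Summits.QuantumFields.BalabanUV.T4Continuum.Support.NE7LatticeUhlenbeckBox
import Summits.QuantumFields.BalabanUV.T4Continuum.Support.TorusGaugeComb
import HarnessLib

/-!
# Support | NE7 chart input (LSUP-EL), assembled: a small Landau gauge with sup letter on a cube of `ℤ⁴`

Informal class name: THE LOCAL LANDAU (UHLENBECK) CHART OF A SMALL-FIELD CONFIGURATION ON A CUBE, `U(N)`, d = 4.

For a unitary configuration `U` on `ℤ⁴` whose plaquettes are within `η` of `1`, a centre `z` and a radius `R`, this file
produces a unitary gauge `u` and a field `A` with, on every bond `(x, κ)` with `|x − z|_∞ ≤ R`: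
`U^u(x, κ) = e^{A(x,κ)}`, `A(x,κ)` skew-adjoint, `‖A(x,κ)‖ ≤ 128·4³·(2R+3)·ε′`, and the (free-boundary, here interior)
Landau / Euler–Lagrange condition `Σ_κ [(W(y,κ) − W(y,κ)ᴴ) − (W(y−e_κ,κ) − W(y−e_κ,κ)ᴴ)] = 0` (`W = U^u`) at every `y` with
`|y − z|_∞ ≤ R` — provided `ε′ ≥ η + 8b₀(e^{4b₀} − 1)` with `b₀ = (π/2)·3(2R+2)η` and the regime conditions (R1), (R2) of
`NE7LatticeUhlenbeckBox.uhlenbeck_box` hold (they read `(2R+3)² ε′ ≪ 1`).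

Proof: translate the cube `z + [−(R+1), R+1]⁴` to `periodBox (2R+3)`; the comb (complete axial) gauge of
`TorusGaugeComb.comb_gauge_box` brings every box bond within `3(2R+2)η` of `1`; take the principal logarithms `B`
(`MatrixLog.exists_isHermitian_exp_eq`, `‖B‖ ≤ b₀`); the plaquettes of `e^{sB}`, `s ∈ [0,1]`, are within `ε′` of `1`
(`NE7GradientCurrency.norm_plaqRem_sub_plaqRem_le`); apply the one-scale lattice Uhlenbeck lemma `uhlenbeck_box`; compose
the two gauges and translate back. This is the hypothesis (LSUP-EL) of `NE7HintOfLandauELChartSU2.hint_of_landauELChart_SU2`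
for one cube (the END file `NE7HintOfUhlenbeckChartSU2` does the bookkeeping).

Worked on by: prover-b2b-balaban-t4-ne7-p1-g93-0 (lineage b2b-balaban-t4-ne7-p1, gen 93: F314a).
-/

open scoped BigOperators Matrix Matrix.Norms.L2Operator
open Finset NormedSpace Set

namespace Summit.QuantumFields.BalabanUV.T4Continuum.NE7CubeLandauChart

open Literature.MathematicalPhysics.QuantumFieldTheory.Balaban1983to89
open B7Prop1Explicit B7Prop2Explicit UnitaryModel MatrixNorms MatrixLog
open T4AveragingDeficitWall (IsUnitaryCfg SmallField)
open T4AveragingDeficitWallBoundary (periodBox mem_periodBox)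
open NE7LatticeUhlenbeckBox (uhlenbeck_box)
open TorusGaugeComb (natSite combGaugePer comb_gauge_box)
open BlockAverageCurrent (smallField_gaugeAct)
open AveragingDeficitKDatum (isUnitaryCfg_gaugeAct)
open AveragingDeficitLiftPeriodic (hol_shift)
open NE7BoxLandauSupAPriori (norm_plaq_linear_le)
open NE7GradientCurrency (norm_plaqRem_sub_plaqRem_le)
open AveragingDeficitCovGrad (hol_plaqWord_units)

variable {n : Type*} [Fintype n] [DecidableEq n] [Nonempty n]

/-! ## §1 The plaquettes of a deformed bond field -/

/-- **THE PLAQUETTES OF `e^{sB}`**: if `‖Bᵢ‖ ≤ b₀`, the `Bᵢ` are skew and `‖e^{B₁}e^{B₂}e^{−B₃}e^{−B₄} − 1‖ ≤ η`, then for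
`s ∈ [0,1]`: `‖e^{sB₁}e^{sB₂}(e^{sB₃})ᴴ(e^{sB₄})ᴴ − 1‖ ≤ η + 8b₀(e^{4b₀} − 1)` (linearise twice, (157)). [folklore] -/
theorem norm_plaq_smul_le {B₁ B₂ B₃ B₄ : Matrix n n ℂ} {b₀ η : ℝ} (h1 : ‖B₁‖ ≤ b₀) (h2 : ‖B₂‖ ≤ b₀) (h3 : ‖B₃‖ ≤ b₀) (h4 : ‖B₄‖ ≤ b₀)
    (hs3 : B₃ ∈ skewAdjoint (Matrix n n ℂ)) (hs4 : B₄ ∈ skewAdjoint (Matrix n n ℂ))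
    (hp : ‖exp B₁ * exp B₂ * exp (-B₃) * exp (-B₄) - 1‖ ≤ η) {s : ℝ} (hs : s ∈ Icc (0 : ℝ) 1) :
    ‖exp ((s : ℂ) • B₁) * exp ((s : ℂ) • B₂) * (exp ((s : ℂ) • B₃))ᴴ * (exp ((s : ℂ) • B₄))ᴴ - 1‖ ≤ η + 8 * b₀ * (Real.exp (4 * b₀) - 1) := by
  have hb₀ : 0 ≤ b₀ := (norm_nonneg _).trans h1
  -- `(e^{sX})ᴴ = e^{−sX}` for skew `X`
  have hcT : ∀ X : Matrix n n ℂ, X ∈ skewAdjoint (Matrix n n ℂ) → (exp ((s : ℂ) • X))ᴴ = exp (-((s : ℂ) • X)) := fun X hX => by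
    have hsX : (s : ℂ) • X ∈ skewAdjoint (Matrix n n ℂ) := by
      have h := skewAdjoint.smul_mem s hX
      rwa [← Complex.coe_smul] at h
    rw [← Matrix.star_eq_conjTranspose, star_exp, (skewAdjoint.mem_iff.mp hsX)]
  -- `‖sX‖ ≤ b₀`
  have hns : ∀ X : Matrix n n ℂ, ‖X‖ ≤ b₀ → ‖(s : ℂ) • X‖ ≤ b₀ := fun X hX => by
    rw [norm_smul, Complex.norm_real, Real.norm_eq_abs, abs_of_nonneg hs.1]
    calc s * ‖X‖ ≤ 1 * ‖X‖ := mul_le_mul_of_nonneg_right hs.2 (norm_nonneg _)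
      _ ≤ b₀ := by rw [one_mul]; exact hX
  rw [hcT B₃ hs3, hcT B₄ hs4]
  have hlin : ‖B₁ + B₂ - B₃ - B₄‖ ≤ η + 4 * b₀ * (Real.exp (4 * b₀) - 1) := norm_plaq_linear_le h1 h2 h3 h4 hp
  have e1 := hns B₁ h1
  have e2 := hns B₂ h2
  have e3 : ‖-((s : ℂ) • B₃)‖ ≤ b₀ := by rw [norm_neg]; exact hns B₃ h3
  have e4 : ‖-((s : ℂ) • B₄)‖ ≤ b₀ := by rw [norm_neg]; exact hns B₄ h4
  have h0 : ‖(0 : Matrix n n ℂ)‖ ≤ b₀ := by rw [norm_zero]; exact hb₀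
  have hrem := norm_plaqRem_sub_plaqRem_le (x₁ := (s : ℂ) • B₁) (x₂ := (s : ℂ) • B₂) (x₃ := -((s : ℂ) • B₃)) (x₄ := -((s : ℂ) • B₄))
    (y₁ := 0) (y₂ := 0) (y₃ := 0) (y₄ := 0) (ρ := b₀) e1 e2 e3 e4 h0 h0 h0 h0
  simp only [exp_zero, mul_one, sub_self, add_zero, sub_zero] at hrem
  have hexp : 0 ≤ Real.exp (4 * b₀) - 1 := by linarith [Real.add_one_le_exp (4 * b₀)]
  have hsum : ‖(s : ℂ) • B₁‖ + ‖(s : ℂ) • B₂‖ + ‖-((s : ℂ) • B₃)‖ + ‖-((s : ℂ) • B₄)‖ ≤ 4 * b₀ := by linarith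
  have hrem' : ‖exp ((s : ℂ) • B₁) * exp ((s : ℂ) • B₂) * exp (-((s : ℂ) • B₃)) * exp (-((s : ℂ) • B₄)) - 1
      - ((s : ℂ) • B₁ + (s : ℂ) • B₂ + -((s : ℂ) • B₃) + -((s : ℂ) • B₄))‖ ≤ 4 * b₀ * (Real.exp (4 * b₀) - 1) := by
    calc _ ≤ (Real.exp (4 * b₀) - 1) * (‖(s : ℂ) • B₁‖ + ‖(s : ℂ) • B₂‖ + ‖-((s : ℂ) • B₃)‖ + ‖-((s : ℂ) • B₄)‖) := hrem
      _ ≤ (Real.exp (4 * b₀) - 1) * (4 * b₀) := mul_le_mul_of_nonneg_left hsum hexp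
      _ = 4 * b₀ * (Real.exp (4 * b₀) - 1) := by ring
  have hlinS : ‖(s : ℂ) • B₁ + (s : ℂ) • B₂ + -((s : ℂ) • B₃) + -((s : ℂ) • B₄)‖ ≤ η + 4 * b₀ * (Real.exp (4 * b₀) - 1) := by
    have hid : (s : ℂ) • B₁ + (s : ℂ) • B₂ + -((s : ℂ) • B₃) + -((s : ℂ) • B₄) = (s : ℂ) • (B₁ + B₂ - B₃ - B₄) := by
      simp only [smul_add, smul_sub]; abel
    rw [hid, norm_smul, Complex.norm_real, Real.norm_eq_abs, abs_of_nonneg hs.1]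
    calc s * ‖B₁ + B₂ - B₃ - B₄‖ ≤ 1 * ‖B₁ + B₂ - B₃ - B₄‖ := mul_le_mul_of_nonneg_right hs.2 (norm_nonneg _)
      _ ≤ _ := by rw [one_mul]; exact hlin
  have hid : exp ((s : ℂ) • B₁) * exp ((s : ℂ) • B₂) * exp (-((s : ℂ) • B₃)) * exp (-((s : ℂ) • B₄)) - 1
      = ((s : ℂ) • B₁ + (s : ℂ) • B₂ + -((s : ℂ) • B₃) + -((s : ℂ) • B₄))
        + (exp ((s : ℂ) • B₁) * exp ((s : ℂ) • B₂) * exp (-((s : ℂ) • B₃)) * exp (-((s : ℂ) • B₄)) - 1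
          - ((s : ℂ) • B₁ + (s : ℂ) • B₂ + -((s : ℂ) • B₃) + -((s : ℂ) • B₄))) := by abel
  rw [hid]
  calc _ ≤ _ := norm_add_le _ _
    _ ≤ (η + 4 * b₀ * (Real.exp (4 * b₀) - 1)) + 4 * b₀ * (Real.exp (4 * b₀) - 1) := add_le_add hlinS hrem'
    _ = _ := by ring

/-! ## §2 The cube chart -/

/-- Cube ↔ translated box: `|x − z|_∞ ≤ R + 1 ⇒ x − lo ∈ periodBox (2R+3)` with `lo = z − (R+1)·𝟙`. [folklore] -/
theorem sub_mem_periodBox {z x : Site 4} {R : ℕ} (hx : ∀ i, |x i - z i| ≤ (R : ℤ) + 1) :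
    x - (fun i => z i - ((R : ℤ) + 1)) ∈ periodBox (d := 4) (2 * R + 2 + 1) := by
  rw [mem_periodBox]
  intro i
  have h := hx i
  rw [abs_le] at h
  simp only [Pi.sub_apply]
  push_cast
  omega

/-- **THE LOCAL LANDAU (UHLENBECK) CHART ON A CUBE**: see the file header. For unitary `U` with `SmallField U η`, `η > 0`,
a radius `R`, a centre `z`, and `ε′ ≥ η + 8b₀(e^{4b₀} − 1)`, `b₀ = (π/2)·3(2R+2)η`, in the regime (R1)–(R2): there are a unitary
gauge `u` and `A` with `U^u = e^{A}`, `A` skew, `‖A‖ ≤ 128·4³·(2R+3)·ε′` on the bonds from the cube `|x − z|_∞ ≤ R`, and the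
Euler–Lagrange (Landau) condition of the trace link functional at every site of that cube. [folklore] -/
theorem cube_landau_chart {U : Site 4 → Fin 4 → (Matrix n n ℂ)ˣ} (hU : IsUnitaryCfg U) {η ε' : ℝ} (hη : 0 < η) (hS : SmallField U η)
    (R : ℕ) (z : Site 4)
    (hε' : η + 8 * (Real.pi / 2 * (3 * ((2 * R + 2 : ℕ) : ℝ) * η)) * (Real.exp (4 * (Real.pi / 2 * (3 * ((2 * R + 2 : ℕ) : ℝ) * η))) - 1) ≤ ε')
    (hR1 : 576 * (64 * ((4 : ℕ) : ℝ) ^ 3 * ((2 * R + 2 + 1 : ℕ) : ℝ)) ^ 2 * ε' ≤ 1)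
    (hR2 : (Fintype.card n : ℝ) * (1 + 2 * ((4 : ℕ) : ℝ) * ((2 * R + 2 + 1 : ℕ) : ℝ)) * (256 * ((4 : ℕ) : ℝ) ^ 3 * ((2 * R + 2 + 1 : ℕ) : ℝ) * ε') ≤ 1 / 2) :
    ∃ (u : Site 4 → (Matrix n n ℂ)ˣ) (A : Site 4 → Fin 4 → Matrix n n ℂ), (∀ x, u x ∈ unitaryUnits (Matrix n n ℂ)) ∧
      (∀ (x : Site 4) (κ : Fin 4), (∀ i, |x i - z i| ≤ (R : ℤ)) → gaugeAct u U x κ = expUnit (A x κ)) ∧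
      (∀ (x : Site 4) (κ : Fin 4), (∀ i, |x i - z i| ≤ (R : ℤ)) → A x κ ∈ skewAdjoint (Matrix n n ℂ)) ∧
      (∀ (x : Site 4) (κ : Fin 4), (∀ i, |x i - z i| ≤ (R : ℤ)) → ‖A x κ‖ ≤ 128 * ((4 : ℕ) : ℝ) ^ 3 * ((2 * R + 2 + 1 : ℕ) : ℝ) * ε') ∧
      (∀ (y : Site 4), (∀ i, |y i - z i| ≤ (R : ℤ)) →
        ∑ κ : Fin 4, ((((gaugeAct u U y κ : (Matrix n n ℂ)ˣ) : Matrix n n ℂ) - ((gaugeAct u U y κ : (Matrix n n ℂ)ˣ) : Matrix n n ℂ)ᴴ)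
          - (((gaugeAct u U (y - e κ) κ : (Matrix n n ℂ)ˣ) : Matrix n n ℂ) - ((gaugeAct u U (y - e κ) κ : (Matrix n n ℂ)ˣ) : Matrix n n ℂ)ᴴ)) = 0) := by
  letI : NormedAlgebra ℚ (Matrix n n ℂ) := NormedAlgebra.restrictScalars ℚ ℂ (Matrix n n ℂ)
  have hcT : ∀ X : Matrix n n ℂ, X ∈ skewAdjoint (Matrix n n ℂ) → (exp X)ᴴ = exp (-X) := fun X hX => by
    rw [← Matrix.star_eq_conjTranspose, star_exp, (skewAdjoint.mem_iff.mp hX)]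
  -- the translated configuration on `periodBox (2R+3)`
  set lo : Site 4 := fun i => z i - ((R : ℤ) + 1) with hlo
  set Mb : ℕ := 2 * R + 2 + 1 with hMb
  set U' : Site 4 → Fin 4 → (Matrix n n ℂ)ˣ := fun y κ => U (y + lo) κ with hU'
  have hU'u : IsUnitaryCfg U' := fun y κ => hU _ _
  have hS' : SmallField U' η := by
    intro x κ κ' hκ
    have h := hol_shift (W := U') (W' := U) (t := lo) (fun _ _ => rfl) (plaqWord κ κ') x
    rw [← h]; exact hS _ κ κ' hκ
  -- the comb gauge
  obtain ⟨hu₀, -, hcomb⟩ := comb_gauge_box hU'u hη.le hS' Mb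
  set u₀ := combGaugePer Mb U' with hu₀def
  set W₀ := gaugeAct u₀ U' with hW₀
  have hW₀u : IsUnitaryCfg W₀ := isUnitaryCfg_gaugeAct hu₀ hU'u
  have hW₀S : SmallField W₀ η := smallField_gaugeAct hu₀ hS'
  set b₀ : ℝ := Real.pi / 2 * (3 * ((2 * R + 2 : ℕ) : ℝ) * η) with hb₀
  have hb₀0 : 0 ≤ b₀ := by positivity
  have hW₀1 : ∀ (x : Site 4) (μ : Fin 4), x ∈ periodBox (d := 4) Mb → x + e μ ∈ periodBox (d := 4) Mb →
      ‖((W₀ x μ : (Matrix n n ℂ)ˣ) : Matrix n n ℂ) - 1‖ ≤ 3 * ((2 * R + 2 : ℕ) : ℝ) * η := by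
    intro x μ hx hxμ
    rw [mem_periodBox] at hx hxμ
    set y : Fin 4 → ℕ := fun i => (x i).toNat with hy
    have hyx : natSite y = x := by
      funext i; simp only [natSite, hy]; exact Int.toNat_of_nonneg (hx i).1
    have hyM : ∀ i, y i < Mb := fun i => by
      have h1 := (hx i).2; have h0 := (hx i).1
      have : ((x i).toNat : ℤ) = x i := Int.toNat_of_nonneg h0
      simp only [hy]; omega
    have hyμ : y μ + 1 < Mb := by
      have h1 := (hxμ μ).2; have h0 := (hx μ).1
      have : ((x μ).toNat : ℤ) = x μ := Int.toNat_of_nonneg h0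
      simp only [Pi.add_apply, e, Pi.single_eq_same] at h1
      simp only [hy]; omega
    have h := hcomb y μ hyM hyμ
    rw [hyx] at h
    have hM1 : ((Mb : ℝ) - 1) = ((2 * R + 2 : ℕ) : ℝ) := by rw [hMb]; push_cast; ring
    rw [hM1] at h; exact h
  -- the logarithms
  have hlog : ∀ (x : Site 4) (μ : Fin 4), ∃ Bx : Matrix n n ℂ, Bx ∈ skewAdjoint (Matrix n n ℂ) ∧ ‖Bx‖ ≤ b₀ ∧
      (x ∈ periodBox (d := 4) Mb → x + e μ ∈ periodBox (d := 4) Mb → exp Bx = ((W₀ x μ : (Matrix n n ℂ)ˣ) : Matrix n n ℂ)) := by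
    intro x μ
    by_cases hx : x ∈ periodBox (d := 4) Mb ∧ x + e μ ∈ periodBox (d := 4) Mb
    · obtain ⟨H, hH, -, hexp, -, hle⟩ := exists_isHermitian_exp_eq (mem_unitaryUnits.mp (hW₀u x μ))
      refine ⟨Complex.I • H, ?_, ?_, fun _ _ => hexp⟩
      · rw [skewAdjoint.mem_iff, star_smul, Complex.star_def, Complex.conj_I, neg_smul, Matrix.star_eq_conjTranspose, hH.eq]
      rw [norm_smul, Complex.norm_I, one_mul]
      calc ‖H‖ ≤ Real.pi / 2 * opDist1 ((W₀ x μ : (Matrix n n ℂ)ˣ) : Matrix n n ℂ) := hle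
        _ ≤ Real.pi / 2 * (3 * ((2 * R + 2 : ℕ) : ℝ) * η) :=
          mul_le_mul_of_nonneg_left (hW₀1 x μ hx.1 hx.2) (by positivity)
    · exact ⟨0, (skewAdjoint (Matrix n n ℂ)).zero_mem, by rw [norm_zero]; exact hb₀0, fun h1 h2 => absurd ⟨h1, h2⟩ hx⟩
  choose B hBskew hBle hBexp using hlog
  -- the plaquettes of `e^{sB}`
  have hε'0 : 0 < ε' := by
    have : 0 ≤ 8 * b₀ * (Real.exp (4 * b₀) - 1) := by
      have : 0 ≤ Real.exp (4 * b₀) - 1 := by linarith [Real.add_one_le_exp (4 * b₀)]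
      positivity
    linarith
  have hplaq : ∀ s ∈ Icc (0 : ℝ) 1, ∀ (q : Site 4) (μ ν : Fin 4), μ ≠ ν → q ∈ periodBox (d := 4) (2 * R + 2 + 1) →
      q + e μ ∈ periodBox (d := 4) (2 * R + 2 + 1) → q + e ν ∈ periodBox (d := 4) (2 * R + 2 + 1) →
      q + e μ + e ν ∈ periodBox (d := 4) (2 * R + 2 + 1) →
      ‖exp ((s : ℂ) • B q μ) * exp ((s : ℂ) • B (q + e μ) ν) * (exp ((s : ℂ) • B (q + e ν) μ))ᴴ * (exp ((s : ℂ) • B q ν))ᴴ - 1‖ ≤ ε' := by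
    intro s hs q μ ν hμν hq hqμ hqν hqμν
    have hqνμ : q + e ν + e μ ∈ periodBox (d := 4) Mb := by rw [add_right_comm]; exact hqμν
    have hp : ‖exp (B q μ) * exp (B (q + e μ) ν) * exp (-B (q + e ν) μ) * exp (-B q ν) - 1‖ ≤ η := by
      rw [hBexp q μ hq hqμ, hBexp (q + e μ) ν hqμ hqμν, ← units_val_inv_eq_exp_neg (hBexp (q + e ν) μ hqν hqνμ).symm,
        ← units_val_inv_eq_exp_neg (hBexp q ν hq hqν).symm]
      have h := hW₀S q μ ν hμν
      rw [hol_plaqWord_units] at h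
      simp only [Units.val_mul] at h
      exact h
    exact (norm_plaq_smul_le (hBle q μ) (hBle _ ν) (hBle _ μ) (hBle q ν) (hBskew _ μ) (hBskew q ν) hp hs).trans hε'
  -- the one-scale lattice Uhlenbeck lemma
  obtain ⟨g, A', hgU, -, -, hA'skew, hA'exp, hA'le, hA'EL⟩ :=
    uhlenbeck_box (d := 4) (n := n) (by norm_num) (m := 2 * R + 2) (by omega) B hBskew hBle hε'0 hplaq hR1 hR2
  -- the composed gauge, translated back
  have hgg : ∀ x, g x * (g x)ᴴ = 1 := fun x => by
    rw [← Matrix.star_eq_conjTranspose]; exact Unitary.mul_star_self_of_mem (hgU x)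
  have hgg' : ∀ x, (g x)ᴴ * g x = 1 := fun x => by
    rw [← Matrix.star_eq_conjTranspose]; exact Unitary.star_mul_self_of_mem (hgU x)
  set gU : Site 4 → (Matrix n n ℂ)ˣ := fun x => ⟨g x, (g x)ᴴ, hgg x, hgg' x⟩ with hgUdef
  have hgUu : ∀ x, gU x ∈ unitaryUnits (Matrix n n ℂ) := fun x => mem_unitaryUnits.mpr (hgU x)
  set u : Site 4 → (Matrix n n ℂ)ˣ := fun x => gU (x - lo) * u₀ (x - lo) with hudef
  set A : Site 4 → Fin 4 → Matrix n n ℂ := fun x κ => A' (x - lo) κ with hAdef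
  have huu : ∀ x, u x ∈ unitaryUnits (Matrix n n ℂ) := fun x => (unitaryUnits (Matrix n n ℂ)).mul_mem (hgUu _) (hu₀ _)
  -- the chart identity on box bonds
  have hchart : ∀ (x : Site 4) (κ : Fin 4), x - lo ∈ periodBox (d := 4) Mb → x - lo + e κ ∈ periodBox (d := 4) Mb →
      ((gaugeAct u U x κ : (Matrix n n ℂ)ˣ) : Matrix n n ℂ) = exp (A x κ) := by
    intro x κ hx hxκ
    have hW : ((W₀ (x - lo) κ : (Matrix n n ℂ)ˣ) : Matrix n n ℂ)
        = ((u₀ (x - lo) : (Matrix n n ℂ)ˣ) : Matrix n n ℂ) * ((U x κ : (Matrix n n ℂ)ˣ) : Matrix n n ℂ)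
          * (((u₀ (x - lo + e κ))⁻¹ : (Matrix n n ℂ)ˣ) : Matrix n n ℂ) := by
      simp only [hW₀, gaugeAct, hU', sub_add_cancel, Units.val_mul]
    have h1 : x + e κ - lo = x - lo + e κ := by abel
    calc ((gaugeAct u U x κ : (Matrix n n ℂ)ˣ) : Matrix n n ℂ)
        = g (x - lo) * (((u₀ (x - lo) : (Matrix n n ℂ)ˣ) : Matrix n n ℂ) * ((U x κ : (Matrix n n ℂ)ˣ) : Matrix n n ℂ)
          * (((u₀ (x - lo + e κ))⁻¹ : (Matrix n n ℂ)ˣ) : Matrix n n ℂ)) * (g (x - lo + e κ))ᴴ := by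
          simp only [gaugeAct, hudef, h1, mul_inv_rev, Units.val_mul, hgUdef, Units.inv_mk, mul_assoc]
      _ = g (x - lo) * exp (B (x - lo) κ) * (g (x - lo + e κ))ᴴ := by rw [← hW, hBexp _ _ hx hxκ]
      _ = exp (A x κ) := (hA'exp _ _ hx hxκ).symm
  -- cube bookkeeping
  have hin : ∀ (x : Site 4), (∀ i, |x i - z i| ≤ (R : ℤ)) → x - lo ∈ periodBox (d := 4) Mb ∧
      (∀ κ, x - lo + e κ ∈ periodBox (d := 4) Mb) ∧ (∀ κ, x - lo - e κ ∈ periodBox (d := 4) Mb) := by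
    intro x hx
    refine ⟨sub_mem_periodBox fun i => (hx i).trans (by omega), fun κ => ?_, fun κ => ?_⟩
    · have h : x - lo + e κ = (x + e κ) - lo := by abel
      rw [h]
      refine sub_mem_periodBox fun i => ?_
      have := hx i
      by_cases hi : i = κ
      · subst hi; simp only [Pi.add_apply, e, Pi.single_eq_same]; rw [abs_le] at this ⊢; omega
      · simp only [Pi.add_apply, e, Pi.single_eq_of_ne hi, add_zero]; exact this.trans (by omega)
    · have h : x - lo - e κ = (x - e κ) - lo := by abel
      rw [h]
      refine sub_mem_periodBox fun i => ?_
      have := hx i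
      by_cases hi : i = κ
      · subst hi; simp only [Pi.sub_apply, e, Pi.single_eq_same]; rw [abs_le] at this ⊢; omega
      · simp only [Pi.sub_apply, e, Pi.single_eq_of_ne hi, sub_zero]; exact this.trans (by omega)
  refine ⟨u, A, huu, fun x κ hx => ?_, fun x κ hx => hA'skew _ _ (hin x hx).1 ((hin x hx).2.1 κ),
    fun x κ hx => hA'le _ _ (hin x hx).1 ((hin x hx).2.1 κ), fun y hy => ?_⟩
  · exact Units.ext (by rw [hchart x κ (hin x hx).1 ((hin x hx).2.1 κ), val_expUnit])
  · obtain ⟨hy0, hyp, hym⟩ := hin y hy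
    have hEL := hA'EL (y - lo) hy0
    rw [← hEL]
    refine Finset.sum_congr rfl fun κ _ => ?_
    rw [if_pos (hyp κ), if_pos (hym κ)]
    have h1 : y - e κ - lo = y - lo - e κ := by abel
    have h2 : y - e κ - lo + e κ = y - lo := by abel
    have hc1 := hchart y κ hy0 (hyp κ)
    have hc2 := hchart (y - e κ) κ (by rw [h1]; exact hym κ) (by rw [h2]; exact hy0)
    rw [hc1, hc2, hcT _ (hA'skew _ _ hy0 (hyp κ)), hAdef]
    simp only [h1]
    rw [hcT _ (hA'skew _ _ (hym κ) (by rw [sub_add_cancel]; exact hy0))]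

end Summit.QuantumFields.BalabanUV.T4Continuum.NE7CubeLandauChart
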